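import Mathlib

/-!
# PercRepro — a circuit-covered extension gains rank at most `3/4` per element (night-1, gen 1; dossier §13.4, the `|S₀| ≤ 13` step)

If `U ⊆ S` and every element of `S ∖ U` lies in a circuit `C ⊆ S` with at most `4` elements, then
`4·r(S) ≤ 3·|S ∖ U| + 4·r(U)`: adding such a circuit to a set `U'` adds `m = |C ∖ U'| ≤ 4` elements and at most `m − 1`
to the rank (`C ∩ U'` is a proper subset of a circuit, hence independent; submodularity), and `4(m − 1) ≤ 3m`.
Equivalently `ν(S) − ν(U) ≥ |S ∖ U| / 4` — the relative form of Corollary N′ (`U = ∅` gives `|S| ≤ 4·ν(S)`), used in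
§13.4 to see that at most `4` further elements of `S₀` lie outside the union of two `6`-point plane sections when the
nullity has one unit to spare (`|S₀| ≤ 13`), and that a single further element already costs one unit of nullity.

* `eRk_union_circuit_le` — `r(U ∪ C) + |C ∩ U| + 1 ≤ r(U) + |C|` for a circuit `C ⊄ U`;
* **`four_mul_eRk_le_of_covered`** — `4·r(S) ≤ 3·|S ∖ U| + 4·r(U)`.
Axioms: standard.
-/

namespace PercRepro

namespace Matroid

open Set

variable {α : Type*} {M : _root_.Matroid α}

/-- **One circuit at a time**: for a circuit `C` not contained in `U`, `r(U ∪ C) + |C ∩ U| + 1 ≤ r(U) + |C|`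
(`C ∩ U` is a proper subset of the circuit, hence independent of rank `|C ∩ U|`; then submodularity). -/
theorem eRk_union_circuit_le {U C : Set α} (hC : M.IsCircuit C) (hCU : ¬ C ⊆ U) :
    M.eRk (U ∪ C) + (C ∩ U).encard + 1 ≤ M.eRk U + C.encard := by
  have hsub := M.eRk_inter_add_eRk_union_le U C
  have hind : M.Indep (C ∩ U) := by
    refine hC.ssubset_indep ?_
    refine Set.inter_subset_left.ssubset_of_ne ?_
    intro h
    exact hCU (h ▸ Set.inter_subset_right)
  have hr : M.eRk (U ∩ C) = (C ∩ U).encard := by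
    rw [Set.inter_comm, hind.eRk_eq_encard]
  have hC' := hC.eRk_add_one_eq
  calc M.eRk (U ∪ C) + (C ∩ U).encard + 1 = (M.eRk (U ∩ C) + M.eRk (U ∪ C)) + 1 := by rw [hr]; ring
    _ ≤ (M.eRk U + M.eRk C) + 1 := by gcongr
    _ = M.eRk U + C.encard := by rw [add_assoc, hC']

/-- **The covered-extension bound**: if `U ⊆ S ⊆ E`, `S` finite, and every element of `S ∖ U` lies in a circuit
`C ⊆ S` with `|C| ≤ 4`, then `4·r(S) ≤ 3·|S ∖ U| + 4·r(U)`. -/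
theorem four_mul_eRk_le_of_covered [M.Finite] {S U : Set α} (hS : S ⊆ M.E) (hUS : U ⊆ S)
    (hcov : ∀ e ∈ S \ U, ∃ C, M.IsCircuit C ∧ C ⊆ S ∧ C.encard ≤ 4 ∧ e ∈ C) :
    4 * M.eRk S ≤ 3 * (S \ U).encard + 4 * M.eRk U := by
  classical
  have hSfin : S.Finite := M.ground_finite.subset hS
  -- strong induction on `|S ∖ U|`, generalizing `U`
  suffices H : ∀ n : ℕ, ∀ U : Set α, U ⊆ S → (S \ U).ncard = n →
      (∀ e ∈ S \ U, ∃ C, M.IsCircuit C ∧ C ⊆ S ∧ C.encard ≤ 4 ∧ e ∈ C) →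
      4 * M.eRk S ≤ 3 * (S \ U).encard + 4 * M.eRk U from H _ U hUS rfl hcov
  intro n
  induction n using Nat.strong_induction_on with
  | _ n ih =>
  intro U hUS hn hcov
  have hWfin : (S \ U).Finite := hSfin.sdiff
  by_cases hW : S \ U = ∅
  · -- `U = S`
    have hUeq : U = S := by
      apply Set.Subset.antisymm hUS
      intro z hz
      by_contra hzU
      exact (Set.eq_empty_iff_forall_notMem.1 hW z) ⟨hz, hzU⟩
    rw [hUeq, Set.sdiff_self, Set.encard_empty]
    simp
  · obtain ⟨e, he⟩ := Set.nonempty_iff_ne_empty.2 hW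
    obtain ⟨C, hC, hCS, hC4, heC⟩ := hcov e he
    have hCU : ¬ C ⊆ U := fun h => he.2 (h heC)
    set U' : Set α := U ∪ C with hU'
    have hU'S : U' ⊆ S := Set.union_subset hUS hCS
    have hUU' : U ⊆ U' := Set.subset_union_left
    have hCfin : C.Finite := hSfin.subset hCS
    -- the new elements `C ∖ U`, `1 ≤ m ≤ 4`
    have hm_pos : 1 ≤ (C \ U).ncard := (Set.ncard_pos (hCfin.sdiff)).2 ⟨e, heC, he.2⟩
    have hm_le : (C \ U).ncard ≤ 4 := by
      have h1 : (C \ U).ncard ≤ C.ncard := Set.ncard_le_ncard Set.sdiff_subset hCfin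
      have h2 : C.ncard ≤ 4 := by
        rw [← hCfin.cast_ncard_eq] at hC4
        exact_mod_cast hC4
      omega
    -- `|S ∖ U| = |S ∖ U'| + |C ∖ U|` and `|S ∖ U'| < |S ∖ U|`
    have hsplit : S \ U = (S \ U') ∪ (C \ U) := by
      ext z
      simp only [hU', Set.mem_sdiff, Set.mem_union, not_or]
      constructor
      · rintro ⟨hzS, hzU⟩
        by_cases hzC : z ∈ C
        · exact Or.inr ⟨hzC, hzU⟩
        · exact Or.inl ⟨hzS, hzU, hzC⟩
      · rintro (⟨hzS, hzU, -⟩ | ⟨hzC, hzU⟩)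
        · exact ⟨hzS, hzU⟩
        · exact ⟨hCS hzC, hzU⟩
    have hdisj : Disjoint (S \ U') (C \ U) := by
      rw [Set.disjoint_left]
      rintro z ⟨-, hzU'⟩ ⟨hzC, -⟩
      exact hzU' (Set.mem_union_right U hzC)
    have hcard : (S \ U).ncard = (S \ U').ncard + (C \ U).ncard := by
      rw [hsplit, Set.ncard_union_eq hdisj (hSfin.sdiff) (hCfin.sdiff)]
    have hlt : (S \ U').ncard < n := by rw [← hn]; omega
    have hcov' : ∀ e ∈ S \ U', ∃ C, M.IsCircuit C ∧ C ⊆ S ∧ C.encard ≤ 4 ∧ e ∈ C :=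
      fun e' he' => hcov e' ⟨he'.1, fun h => he'.2 (Set.mem_union_left C h)⟩
    have hIH := ih _ hlt U' hU'S rfl hcov'
    -- the rank of `U' = U ∪ C`: `r(U') + |C ∩ U| + 1 ≤ r(U) + |C|`, i.e. `r(U') ≤ r(U) + m − 1`
    have hstep := eRk_union_circuit_le (M := M) (U := U) hC hCU
    -- pass to `ℕ`
    have hUfin : U.Finite := hSfin.subset hUS
    have hneS : M.eRk S ≠ ⊤ := ((M.eRk_le_encard _).trans_lt hSfin.encard_lt_top).ne
    have hneU : M.eRk U ≠ ⊤ := ((M.eRk_le_encard _).trans_lt hUfin.encard_lt_top).ne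
    have hneU' : M.eRk U' ≠ ⊤ :=
      ((M.eRk_le_encard _).trans_lt (hSfin.subset hU'S).encard_lt_top).ne
    obtain ⟨rS, hrS⟩ := ENat.ne_top_iff_exists.1 hneS
    obtain ⟨rU, hrU⟩ := ENat.ne_top_iff_exists.1 hneU
    obtain ⟨rU', hrU'⟩ := ENat.ne_top_iff_exists.1 hneU'
    have hCU_card : (C ∩ U).ncard + (C \ U).ncard = C.ncard := by
      rw [← Set.ncard_inter_add_ncard_sdiff_eq_ncard C U hCfin]
    rw [← hrU', ← hrU, ← (hCfin.inter_of_left U).cast_ncard_eq, ← hCfin.cast_ncard_eq] at hstep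
    rw [← hrS, ← hrU', ← (hSfin.sdiff (t := U')).cast_ncard_eq] at hIH
    rw [← hrS, ← hrU, ← hWfin.cast_ncard_eq]
    have e1 : rU' + (C ∩ U).ncard + 1 ≤ rU + C.ncard := by exact_mod_cast hstep
    have e2 : 4 * rS ≤ 3 * (S \ U').ncard + 4 * rU' := by exact_mod_cast hIH
    have e3 : 4 * rS ≤ 3 * (S \ U).ncard + 4 * rU := by
      rw [hcard]
      omega
    exact_mod_cast e3

end Matroid

end PercRepro
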